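import Summits.AtomisticToContinuum.Crystallization.Theorems.FrustratedLawDichotomyStrainedPatchHomCentredForm

/-!
# Non-negativity near a ZERO with positive slope — the ray lemma for the one-atom move-stability certificate (def-free)

decomp-a2c hand-1 g19 (27623 strained-patch piece; (R)-side witness item (d) of hand-2's `…StrainedPatchHomWitness`: the reference homogeneous
site must be MOVE-STABLE, `Σ_window LJ‖q − v‖ − Σ_window LJ‖v‖ + ‖q‖·σ(‖q‖) ≥ 0` for `‖q‖ < 7/10`).  At `q = 0` the functional VANISHES, so a
box certificate has no margin there; the standard device is a RAY argument: along `t ↦ q = t·u` the functional `g` has `g 0 = 0`, slope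
`g′(0) ≥ κ > 0` (`κ = σ(0) − |force·u|`, positive at a force-capped site) and curvature `≥ −M`, hence `g t ≥ κ t − M t²/2 ≥ 0` for
`0 ≤ t ≤ 2κ/M`; boxes cover the rest.  This file: the 1-D lemma from `…HomCentredForm.tangent_parabola_le` (`nonneg_of_slope_of_curvature`,
`pos_of_slope_of_curvature`), its packaging over all unit directions (`nonneg_on_ball_of_rays`), and the LIFTED-COORDINATE identity
`‖q − v‖² = ‖q‖² − 2⟪q, v⟫ + ‖v‖²` that makes every window term a univariate function of a LINEAR functional of `(q, ‖q‖²)` — the input shape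
of `leaf_sound_box_fintype` for the boxes away from the origin.  Standard axioms; no definitions.  `--supports stmt-AtomisticToContinuum-27623`.
-/

noncomputable section

namespace Summit.AtomisticToContinuum.Crystallization.Theorems.FrustratedLawDichotomyStrainedPatchHomRay

open scoped RealInnerProductSpace
open Set
open Summit.AtomisticToContinuum.Crystallization.Theorems.FrustratedLawDichotomyStrainedPatchHomCentredForm

/-! ## §1. One dimension -/

/-- ★ **Ray lemma.**  `g 0 = 0`, `g` differentiable on `[0, T]` with `g′ + M·id` monotone (curvature `≥ −M`), slope `κ ≤ g′ 0`:
then `κ t − (M/2) t² ≤ g t` on `[0, T]`. [folklore] -/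
theorem slope_parabola_le {g g' : ℝ → ℝ} {T M κ t : ℝ} (hT : 0 ≤ T) (h0 : g 0 = 0)
    (hd : ∀ s ∈ Icc 0 T, HasDerivAt g (g' s) s) (hmono : MonotoneOn (fun s => g' s + M * s) (Icc 0 T))
    (hκ : κ ≤ g' 0) (ht : t ∈ Icc 0 T) : κ * t - M / 2 * t ^ 2 ≤ g t := by
  have h := tangent_parabola_le (φ := g) (φ' := g') (q₀ := 0) (left_mem_Icc.2 hT) ht hd hmono
  rw [h0, sub_zero] at h
  have hκt : κ * t ≤ g' 0 * t := mul_le_mul_of_nonneg_right hκ ht.1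
  linarith

/-- ★ **Non-negativity near the zero**: under the same hypotheses with `0 ≤ M`, `g t ≥ 0` for `0 ≤ t ≤ min T (2κ/M)` — stated as:
`t ∈ [0,T]` and `M·t ≤ 2κ` imply `0 ≤ g t`. [folklore] -/
theorem nonneg_of_slope_of_curvature {g g' : ℝ → ℝ} {T M κ t : ℝ} (hT : 0 ≤ T) (h0 : g 0 = 0)
    (hd : ∀ s ∈ Icc 0 T, HasDerivAt g (g' s) s) (hmono : MonotoneOn (fun s => g' s + M * s) (Icc 0 T))
    (hκ : κ ≤ g' 0) (ht : t ∈ Icc 0 T) (hMt : M * t ≤ 2 * κ) : 0 ≤ g t := by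
  have h := slope_parabola_le hT h0 hd hmono hκ ht
  have : 0 ≤ κ * t - M / 2 * t ^ 2 := by nlinarith [ht.1]
  linarith

/-- Strict version away from the origin: `0 < t`, `M·t < 2κ` ⟹ `0 < g t`. [folklore] -/
theorem pos_of_slope_of_curvature {g g' : ℝ → ℝ} {T M κ t : ℝ} (hT : 0 ≤ T) (h0 : g 0 = 0)
    (hd : ∀ s ∈ Icc 0 T, HasDerivAt g (g' s) s) (hmono : MonotoneOn (fun s => g' s + M * s) (Icc 0 T))
    (hκ : κ ≤ g' 0) (ht : t ∈ Icc 0 T) (ht0 : 0 < t) (hMt : M * t < 2 * κ) : 0 < g t := by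
  have h := slope_parabola_le hT h0 hd hmono hκ ht
  have : 0 < κ * t - M / 2 * t ^ 2 := by nlinarith [ht.1]
  linarith

/-! ## §2. All rays at once -/

/-- ★★ **NON-NEGATIVITY ON A BALL FROM RAY DATA.**  `F : E3 → ℝ` with `F 0 = 0`; for every unit direction `u` the ray function
`t ↦ F (t • u)` is differentiable on `[0, r]` with derivative `D u t`, `D u · + M·id` monotone there, and `κ ≤ D u 0`; if `M·r ≤ 2κ` then
`0 ≤ F q` for every `‖q‖ ≤ r`. [folklore] -/
theorem nonneg_on_ball_of_rays {F : EuclideanSpace ℝ (Fin 3) → ℝ} {D : EuclideanSpace ℝ (Fin 3) → ℝ → ℝ} {r M κ : ℝ}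
    (hr : 0 ≤ r) (h0 : F 0 = 0)
    (hd : ∀ u : EuclideanSpace ℝ (Fin 3), ‖u‖ = 1 → ∀ s ∈ Icc 0 r, HasDerivAt (fun t => F (t • u)) (D u s) s)
    (hmono : ∀ u : EuclideanSpace ℝ (Fin 3), ‖u‖ = 1 → MonotoneOn (fun s => D u s + M * s) (Icc 0 r))
    (hκ : ∀ u : EuclideanSpace ℝ (Fin 3), ‖u‖ = 1 → κ ≤ D u 0) (hMr : M * r ≤ 2 * κ) (hM : 0 ≤ M)
    (q : EuclideanSpace ℝ (Fin 3)) (hq : ‖q‖ ≤ r) : 0 ≤ F q := by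
  by_cases hq0 : q = 0
  · rw [hq0, h0]
  · have hnq : 0 < ‖q‖ := norm_pos_iff.2 hq0
    set u : EuclideanSpace ℝ (Fin 3) := ‖q‖⁻¹ • q with hu
    have hun : ‖u‖ = 1 := by rw [hu, norm_smul, norm_inv, norm_norm, inv_mul_cancel₀ hnq.ne']
    have hqu : ‖q‖ • u = q := by rw [hu, smul_smul, mul_inv_cancel₀ hnq.ne', one_smul]
    have hg0 : F ((0 : ℝ) • u) = 0 := by simp [h0]
    have h := nonneg_of_slope_of_curvature (g := fun t => F (t • u)) hr hg0 (hd u hun) (hmono u hun) (hκ u hun)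
      ⟨hnq.le, hq⟩ (le_trans (mul_le_mul_of_nonneg_left hq hM) hMr)
    simpa only [hqu] using h

/-! ## §3. Lifted coordinates for the window terms away from the origin -/

/-- `‖q − v‖² = ‖q‖² − 2⟪q, v⟫ + ‖v‖²`: with the lifted coordinate `s = ‖q‖²` every window term `LJ ‖q − v‖` is `(LJ ∘ √)` of a LINEAR
functional of `(q, s)` — the shape consumed by `…HomGramHcp.leaf_sound_box_fintype` on boxes away from `q = 0`. [folklore] -/
theorem norm_sub_sq_eq_lifted (q v : EuclideanSpace ℝ (Fin 3)) : ‖q - v‖ ^ 2 = ‖q‖ ^ 2 - 2 * ⟪q, v⟫ + ‖v‖ ^ 2 := by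
  rw [← real_inner_self_eq_norm_sq, ← real_inner_self_eq_norm_sq, ← real_inner_self_eq_norm_sq, inner_sub_left, inner_sub_right,
    inner_sub_right, real_inner_comm v q]
  ring

/-- The lifted coordinate is confined by the box: `‖q‖² = Σᵢ qᵢ²`. [formal bookkeeping] -/
theorem norm_sq_eq_sum_sq (q : EuclideanSpace ℝ (Fin 3)) : ‖q‖ ^ 2 = ∑ i, q i ^ 2 := by
  rw [EuclideanSpace.norm_sq_eq]
  exact Finset.sum_congr rfl fun i _ => by rw [Real.norm_eq_abs, sq_abs]

end Summit.AtomisticToContinuum.Crystallization.Theorems.FrustratedLawDichotomyStrainedPatchHomRay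

end
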